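import Mathlib
import Literature.MathematicalPhysics.QuantumFieldTheory.Balaban1983to89.B14Interpolation

/-!
# `Balaban1983to89.B14InterpolationMeasure` — [Balaban1988Convergent] (3.27) p. 271 (with (3.26) p. 271, (3.30) p. 272,
(3.32) p. 273) FOR ACTUAL INTEGRALS: the derivative of the logarithm of a parametrised integral is the expectation in the
tilted probability measure — the measure-theoretic content of the sentence defining `⟨·⟩_{s,t}` in (3.27)

statement-level skeleton of published theorems with citation tags; proofs where landed; nothing here is a
claim about the Yang–Mills mass gap

PDF held: `paper:balaban1988-cmp119-convergent-renormalization` (journal page = PDF page + 242; displays (3.26)–(3.27)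
read on the x2 render p029, (3.30) on p030, (3.32) on p031 of
`run/shared/lean/pub/pub-balaban/b2b-balaban-ref1/pages/1988-cmp119-convergent-renormalization/`).

CITATION HEADER (lean-in-tree rule).  Source: T. Bałaban, *Convergent renormalization expansions for lattice gauge
theories*, Commun. Math. Phys. **119**, 243–285 (1988), doi:10.1007/bf01217741 [Balaban1988Convergent] (cell paper
B14).  Mega-formalization `lit-balaban` (HOME `run/shared/lean/pub/lit-balaban/`), Phase-2 proof seat p27, generation 2
(unit `lit-balaban-p27`; generation 1 landed `B14TentUnityTorus`).  WHAT IS REPRODUCED: SKELETON rows **B14.Eq3.27**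
(decl of record `B14.Interpolation.tiltedSum`/`hasDerivAt_log_tiltedSum`, the FINITE model), **B14.Eq3.26**
(`B14.Interpolation.Eq326`), **B14.Eq3.30** and **B14.Eq3.31-3.32** (`B14.Interpolation.Eq330`) — here for genuine
integrals against a measure.  The row-of-record file `B14Interpolation` (unit `lit-balaban-r11`) says verbatim: *"The
measure-theoretic interchange for the actual fluctuation integrals (compact domain cut out by `χ^{(k)}`, analytic
integrand) is NOT typed here."*  This file types AND proves it.

THE PRINTED TEXT (verbatim, pp. 271–273 [PDF 29–31]).
* (3.26)–(3.27) p. 271: *"Introduce now auxiliary parameters s, t, the parameter t multiplying the expressions 𝐁_k,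
  A((1/g_k²(·)) − (1/g_k²), …), V^{(k)}, s multiplying 𝐑″_k. We have
  log[z^{(k)} ∫ dA χ^{(k)} exp[−½⟨A, C*Δ^{(k)}CA⟩ − ….]] = ∫₀¹ dt ⟨{…} + V^{(k)}(S_{k+1})⟩_{s=1,t}
   + ∫₀¹ ds ⟨{𝐑″_k(U_k(….)) − 𝐑″_k(U_{k+1})}⟩_{s,t=0} + log[z^{(k)} ∫ dA χ^{(k)} exp[… (s = 0, t = 0) …]].   (3.26)
  Here ⟨·⟩_{s,t} denotes the expectation value with respect to the probabilistic measure
  Z_{s,t}^{−1} dμ_{C^{(k)}(Λ_{k+1})}(A) χ_k exp[−⟨A, C*Δ^{(k)}CA_k⟩ + 𝐏^{(k)} + {….}_{s,t} + tV^{(k)}(S_k)],   (3.27)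
  where the introduction of the parameters s, t was described above, and Z_{s,t} is the normalization factor."*
* (3.30) p. 272: *"Multiplying g_k by the parameter t we have [the logarithm on the right-hand side of (3.28)]
  = log[z^{(k)} ∫ dA exp[−½⟨A, C*Δ^{(k)}CA⟩]] + log[…] + ∫₀¹ dt ⟨(d/dt)(−𝐏^{(k)}(tg_k, A) + … E_k(U_k(…tg_kCA…)))⟩_t,
  where the expectation value is with respect to the probabilistic measure defined by the function χ^{(k)} exp[…tg_k…]
  in the logarithm, but with the constant g_k replaced by tg_k."*
* (3.32) p. 273: *"Denote the characteristic function with the parameter t multiplying the variables A by χ_t^{(k)}.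
  Thus there is the function χ_1^{(k)} in this expression, and χ_0^{(k)} = 1. We have
  log ∫ dμ_{C^{(k)}(Λ_{k+1})} χ_1^{(k)} = ∫₀¹ dt ∫ dμ_{C^{(k)}(Λ_{k+1})} ((d/dt)χ_t^{(k)}) (∫ dμ_{C^{(k)}(Λ_{k+1})} χ_t^{(k)})^{−1}.
  (3.32)"*

WHAT IS TYPED AND PROVED (arbitrary measure space `(Ω, ν)`; in print `ν = dμ_{C^{(k)}(Λ_{k+1})}`, a finite Gaussian
measure on the finite-dimensional space of the fluctuation variables `A`).
§1 GENERAL DIFFERENTIABLE FAMILY ((3.32) shape).  Data `DomFamily ν F F' a b`: an integrand `F t ω`, `t` in an open interval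
  `(a, b) ⊃ [0, 1]`, measurable and integrable sections, a.e. differentiable in `t` with derivative `F' t ω` dominated by
  one integrable function, integrals `Z(t) = ∫ F_t dν > 0` (the printed logarithms exist).  PROVED: `hasDerivAt_integral`
  (Mathlib's dominated differentiation under the integral sign), `hasDerivAt_log_integral`, `intervalIntegrable_logDeriv`,
  and the displays `eq330_family : B14.Interpolation.Eq330 (log Z) (t ↦ (∫ ∂_tF_t)·Z(t)⁻¹)`, `eq332_family` — (3.32)
  verbatim: `log ∫ F_1 dν = ∫₀¹ dt (∫ ∂_tF_t dν)(∫ F_t dν)⁻¹` when `∫ F_0 dν = 1` ("χ_0^{(k)} = 1").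
§2 GIBBS FORM ((3.27), (3.30)).  Data `GibbsFamily ν w S S' a b`: a reference weight `w ≥ 0` a.e., integrable, of positive
  integral (in print `χ_k exp[−⟨A, C*Δ^{(k)}CA_k⟩ + 𝐏^{(k)} + …]`), and an exponent `S t ω` ("{….}_{s,t} + tV^{(k)}(S_k)",
  resp. "… with g_k replaced by tg_k"), measurable, a.e. bounded with a.e. bounded `t`-derivative `S' t ω` on `(a, b)` —
  in print bounded analytic functions on the field domain cut out by the characteristic functions `χ`, (2.19)–(2.23),
  (2.36)–(2.42); the bounds enter only qualitatively.  Objects: `gibbsWeight w S t = w·e^{S_t}`, `partFn ν w S t = Z_t`,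
  `gibbsExpect ν w S G t = ⟨G⟩_t = Z_t⁻¹ ∫ G w e^{S_t} dν`, and the PROBABILITY MEASURE of (3.27) `gibbsLaw ν w S t`
  (`isProbabilityMeasure_gibbsLaw`; `integral_gibbsLaw`: `⟨G⟩_t` IS the integral against it).  PROVED: `partFn_pos`,
  `hasDerivAt_partFn`, **`hasDerivAt_log_partFn`: `d/dt log Z_t = ⟨∂_tS_t⟩_t`** — the meaning of `⟨·⟩_{s,t}` in (3.27)
  for actual integrals; `abs_gibbsExpect_le`; `eq330_gibbs : Eq330 (log Z) (t ↦ ⟨∂_tS_t⟩_t)` ((3.30); (3.32) in Gibbs form).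
§3–§4 (companion file `B14Eq326Measure`, same seat): the two-parameter family `S_{s,t} = sX + tY` of (3.26)–(3.27) with
  `eq326_linear : B14.Interpolation.Eq326 (log Z) ⟨Y⟩ ⟨X⟩` for actual integrals; consistency with the finite model.

DESIGN / WHAT IS NOT HERE.  Hypotheses are binders on an open parameter interval `(a,b) ⊃ [0,1]`, so that the two-sided
derivatives at `t = 0, 1` used by `B14.Interpolation.eq330_of_hasDerivAt` exist (Bałaban's expressions are analytic in the
parameters).  The interval integrability of `t ↦ ⟨∂_tS_t⟩_t` needs NO continuity of `S'` in `t`: the quotient is the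
derivative of `log Z`, hence Borel (`measurable_deriv`), and bounded.  The identification of `w`, `S` with Bałaban's
densities (the inductive spaces of §2 of the paper) is NOT made here — this is the calculus lemma the displays rest on.
Related tree material (not imported, different statements): the [folklore] exponential-family calculus of
`T4CovarianceResponse` (`expTilt q₀ g θ = q₀e^{−θg}`, finite measure, everywhere-bounded data, response identity); this file
has a.e. hypotheses on an arbitrary measure, the (3.27) sign, and proves the LOG-derivative / FTC displays.  No `sorry`.
-/

noncomputable section

open _root_.MeasureTheory _root_.Set _root_.Filter
open scoped Topology ENNReal BigOperators

namespace Literature.MathematicalPhysics.QuantumFieldTheory.Balaban1983to89.B14.InterpolationMeasure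

variable {Ω : Type*} [MeasurableSpace Ω]

/-! ## §1  A dominated differentiable family of integrands: `d/dt log ∫ F_t dν = (∫ ∂_t F_t dν)(∫ F_t dν)⁻¹` — (3.32) -/

/-- The standing data of a parametrised integrand `F t ω`, `t ∈ (a,b) ⊃ [0,1]` (in (3.32): `F_t = χ_t^{(k)}`, the
characteristic function with the parameter `t` multiplying the variables `A`, against `dμ_{C^{(k)}(Λ_{k+1})}`): measurable and
integrable sections, a.e. differentiable in `t` with an integrably DOMINATED derivative `F'` (*"(d/dt)χ_t^{(k)} can be
written as a sum of terms, for which only one characteristic function in the product is differentiated"*, p. 273 — bounded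
functions on a finite measure space), and positive integrals (the printed logarithms exist).
[cite: Balaban1988Convergent, (3.32) p.273] -/
structure DomFamily (ν : Measure Ω) (F F' : ℝ → Ω → ℝ) (a b : ℝ) : Prop where
  /-- the parameter interval `(a,b)` contains `[0,1]`: left end -/
  lo : a < 0
  /-- … right end -/
  hi : 1 < b
  /-- each section `F t` is a.e.-strongly measurable -/
  F_meas : ∀ t ∈ Ioo a b, AEStronglyMeasurable (F t) ν
  /-- each derivative section `F' t` is a.e.-strongly measurable -/
  F'_meas : ∀ t ∈ Ioo a b, AEStronglyMeasurable (F' t) ν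
  /-- each section is integrable -/
  F_int : ∀ t ∈ Ioo a b, Integrable (F t) ν
  /-- for a.e. `ω`, `t ↦ F t ω` is differentiable on `(a,b)` with derivative `F' t ω` -/
  F_deriv : ∀ᵐ ω ∂ν, ∀ t ∈ Ioo a b, HasDerivAt (fun t => F t ω) (F' t ω) t
  /-- the derivatives are dominated by one integrable function -/
  F'_bdd : ∃ bound : Ω → ℝ, Integrable bound ν ∧ ∀ᵐ ω ∂ν, ∀ t ∈ Ioo a b, |F' t ω| ≤ bound ω
  /-- the integrals are positive on `(a,b)` (so that `log ∫ F_t dν` is meaningful) -/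
  pos : ∀ t ∈ Ioo a b, 0 < ∫ ω, F t ω ∂ν

namespace DomFamily

variable {ν : Measure Ω} {F F' : ℝ → Ω → ℝ} {a b : ℝ}

/-- `[0,1] ⊂ (a,b)`. [cite: Balaban1988Convergent, (3.32) p.273] -/
theorem Icc_subset (h : DomFamily ν F F' a b) : Icc (0:ℝ) 1 ⊆ Ioo a b :=
  fun _ ht => ⟨lt_of_lt_of_le h.lo ht.1, lt_of_le_of_lt ht.2 h.hi⟩

/-- `uIcc 0 1 ⊂ (a,b)`. [cite: Balaban1988Convergent, (3.32) p.273] -/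
theorem uIcc_subset (h : DomFamily ν F F' a b) : uIcc (0:ℝ) 1 ⊆ Ioo a b := by rw [uIcc_of_le zero_le_one]; exact h.Icc_subset

/-- DIFFERENTIATION UNDER THE INTEGRAL SIGN (dominated form): `d/dt ∫ F_t dν = ∫ ∂_tF_t dν` at every `t₀ ∈ (a,b)` — the
interchange behind *"∫ dμ ((d/dt)χ_t^{(k)})"* in (3.32). [cite: Balaban1988Convergent, (3.32) p.273] -/
theorem hasDerivAt_integral (h : DomFamily ν F F' a b) {t₀ : ℝ} (ht₀ : t₀ ∈ Ioo a b) :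
    HasDerivAt (fun t => ∫ ω, F t ω ∂ν) (∫ ω, F' t₀ ω ∂ν) t₀ := by
  obtain ⟨bound, hbi, hbd⟩ := h.F'_bdd
  have hs : Ioo a b ∈ 𝓝 t₀ := isOpen_Ioo.mem_nhds ht₀
  have hF_meas : ∀ᶠ t in 𝓝 t₀, AEStronglyMeasurable (F t) ν :=
    Filter.eventually_of_mem hs fun t ht => h.F_meas t ht
  have h_bound : ∀ᵐ ω ∂ν, ∀ t ∈ Ioo a b, ‖F' t ω‖ ≤ bound ω := by
    filter_upwards [hbd] with ω hω t ht
    rw [Real.norm_eq_abs]; exact hω t ht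
  exact (hasDerivAt_integral_of_dominated_loc_of_deriv_le hs hF_meas (h.F_int t₀ ht₀) (h.F'_meas t₀ ht₀) h_bound hbi
    h.F_deriv).2

/-- THE LOG-DERIVATIVE: `d/dt log ∫ F_t dν = (∫ ∂_tF_t dν)·(∫ F_t dν)⁻¹` on `(a,b)` — the integrand of (3.32).
[cite: Balaban1988Convergent, (3.32) p.273] -/
theorem hasDerivAt_log_integral (h : DomFamily ν F F' a b) {t₀ : ℝ} (ht₀ : t₀ ∈ Ioo a b) :
    HasDerivAt (fun t => Real.log (∫ ω, F t ω ∂ν)) ((∫ ω, F' t₀ ω ∂ν) / ∫ ω, F t₀ ω ∂ν) t₀ :=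
  (h.hasDerivAt_integral ht₀).log (h.pos t₀ ht₀).ne'

/-- The integrals are bounded BELOW by a positive constant on `[0,1]` (they are continuous — differentiable — and
positive on a compact set). [cite: Balaban1988Convergent, (3.32) p.273] -/
theorem exists_pos_le_integral (h : DomFamily ν F F' a b) :
    ∃ m : ℝ, 0 < m ∧ ∀ t ∈ Icc (0:ℝ) 1, m ≤ ∫ ω, F t ω ∂ν := by
  obtain ⟨t₁, ht₁, hmin⟩ := isCompact_Icc.exists_isMinOn (nonempty_Icc.2 (zero_le_one' ℝ))
    (fun t ht => (h.hasDerivAt_integral (h.Icc_subset ht)).continuousAt.continuousWithinAt)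
  exact ⟨∫ ω, F t₁ ω ∂ν, h.pos t₁ (h.Icc_subset ht₁), fun t ht => hmin ht⟩

/-- `|∫ ∂_tF_t dν| ≤ ∫ bound dν` on `(a,b)` under the domination. [cite: Balaban1988Convergent, (3.32) p.273] -/
theorem abs_integral_deriv_le {bound : Ω → ℝ} (hbi : Integrable bound ν)
    (hbd : ∀ᵐ ω ∂ν, ∀ t ∈ Ioo a b, |F' t ω| ≤ bound ω) {t : ℝ} (ht : t ∈ Ioo a b) :
    |∫ ω, F' t ω ∂ν| ≤ ∫ ω, bound ω ∂ν := by
  have h1 : ‖∫ ω, F' t ω ∂ν‖ ≤ ∫ ω, bound ω ∂ν := by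
    apply MeasureTheory.norm_integral_le_of_norm_le hbi
    filter_upwards [hbd] with ω hω
    rw [Real.norm_eq_abs]; exact hω t ht
  simpa [Real.norm_eq_abs] using h1

/-- The log-derivative `t ↦ (∫ ∂_tF_t dν)(∫ F_t dν)⁻¹` is interval-integrable on `[0,1]`: it is the derivative of
`log ∫ F_t dν` (hence Borel measurable) and bounded — no continuity in `t` is needed.
[cite: Balaban1988Convergent, (3.32) p.273] -/
theorem intervalIntegrable_logDeriv (h : DomFamily ν F F' a b) :
    IntervalIntegrable (fun t => (∫ ω, F' t ω ∂ν) / ∫ ω, F t ω ∂ν) volume 0 1 := by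
  obtain ⟨bound, hbi, hbd⟩ := h.F'_bdd
  obtain ⟨m, hm, hmle⟩ := h.exists_pos_le_integral
  set φ : ℝ → ℝ := fun t => Real.log (∫ ω, F t ω ∂ν) with hφ
  have hderiv : ∀ t ∈ Icc (0:ℝ) 1, deriv φ t = (∫ ω, F' t ω ∂ν) / ∫ ω, F t ω ∂ν :=
    fun t ht => (h.hasDerivAt_log_integral (h.Icc_subset ht)).deriv
  have hmeas : Measurable (deriv φ) := measurable_deriv φ
  have hbdd : ∀ t ∈ Icc (0:ℝ) 1, ‖deriv φ t‖ ≤ (∫ ω, bound ω ∂ν) / m := by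
    intro t ht
    rw [hderiv t ht, Real.norm_eq_abs, abs_div, abs_of_pos (h.pos t (h.Icc_subset ht))]
    exact div_le_div₀ (integral_nonneg_of_ae (by
        filter_upwards [hbd] with ω hω
        exact (abs_nonneg _).trans (hω 0 (h.Icc_subset ⟨le_rfl, zero_le_one⟩))))
      (abs_integral_deriv_le hbi hbd (h.Icc_subset ht)) hm (hmle t ht)
  have hint : IntegrableOn (deriv φ) (Icc (0:ℝ) 1) volume :=
    Measure.integrableOn_of_bounded (measure_Icc_lt_top.ne) hmeas.aestronglyMeasurable
      ((ae_restrict_iff' measurableSet_Icc).2 (ae_of_all _ hbdd))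
  have hint' : IntegrableOn (fun t => (∫ ω, F' t ω ∂ν) / ∫ ω, F t ω ∂ν) (Icc (0:ℝ) 1) volume :=
    hint.congr_fun (fun t ht => hderiv t ht) measurableSet_Icc
  have huIcc : uIcc (0:ℝ) 1 = Icc 0 1 := uIcc_of_le zero_le_one
  exact (huIcc ▸ hint').intervalIntegrable

/-- **(3.30)/(3.32) for a dominated differentiable family**: `log ∫ F_1 dν = log ∫ F_0 dν + ∫₀¹ dt (∫ ∂_tF_t dν)(∫ F_t dν)⁻¹`
— the row-of-record display `B14.Interpolation.Eq330`, for ACTUAL integrals. [cite: Balaban1988Convergent, (3.30) p.272, (3.32) p.273] -/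
theorem eq330_family (h : DomFamily ν F F' a b) :
    B14.Interpolation.Eq330 (fun t => Real.log (∫ ω, F t ω ∂ν)) (fun t => (∫ ω, F' t ω ∂ν) / ∫ ω, F t ω ∂ν) :=
  B14.Interpolation.eq330_of_hasDerivAt _ _ (fun _ ht => h.hasDerivAt_log_integral (h.uIcc_subset ht))
    h.intervalIntegrable_logDeriv

/-- **(3.32) verbatim**: if `∫ F_0 dν = 1` (*"χ_0^{(k)} = 1"* against the normalised Gaussian measure), then
`log ∫ F_1 dν = ∫₀¹ dt (∫ ∂_tF_t dν) (∫ F_t dν)⁻¹`. [cite: Balaban1988Convergent, (3.32) p.273] -/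
theorem eq332_family (h : DomFamily ν F F' a b) (h0 : ∫ ω, F 0 ω ∂ν = 1) :
    Real.log (∫ ω, F 1 ω ∂ν) = ∫ t in (0:ℝ)..1, (∫ ω, F' t ω ∂ν) * (∫ ω, F t ω ∂ν)⁻¹ := by
  have h1 := h.eq330_family
  unfold B14.Interpolation.Eq330 at h1
  dsimp only at h1
  rw [h0, Real.log_one, zero_add] at h1
  simpa [div_eq_mul_inv] using h1

end DomFamily

/-! ## §2  The Gibbs form of (3.27): reference weight `w`, exponent `S_t`, tilted expectation `⟨·⟩_t` -/

/-- The tilted weight `w·e^{S_t}` — the density of the measure in (3.27) relative to `dμ_{C^{(k)}(Λ_{k+1})}` before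
normalization (`w = χ_k exp[−⟨A,C*Δ^{(k)}CA_k⟩ + 𝐏^{(k)} + …]`, `S_t` = the parametrised part of the exponent).
[cite: Balaban1988Convergent, (3.27) p.271] -/
def gibbsWeight (w : Ω → ℝ) (S : ℝ → Ω → ℝ) (t : ℝ) (ω : Ω) : ℝ := w ω * Real.exp (S t ω)

/-- The normalization factor `Z_t = ∫ w e^{S_t} dν` of (3.27) (*"Z_{s,t} is the normalization factor"*); its logarithm is
the left-hand side of (3.26)/(3.30). [cite: Balaban1988Convergent, (3.27) p.271] -/
def partFn (ν : Measure Ω) (w : Ω → ℝ) (S : ℝ → Ω → ℝ) (t : ℝ) : ℝ := ∫ ω, gibbsWeight w S t ω ∂ν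

/-- The un-normalised tilted integral `∫ G w e^{S_t} dν` of an insert `G`. [cite: Balaban1988Convergent, (3.27) p.271] -/
def gibbsNum (ν : Measure Ω) (w : Ω → ℝ) (S : ℝ → Ω → ℝ) (G : Ω → ℝ) (t : ℝ) : ℝ :=
  ∫ ω, G ω * gibbsWeight w S t ω ∂ν

/-- THE TILTED EXPECTATION `⟨G⟩_t = Z_t⁻¹ ∫ G w e^{S_t} dν` — *"the expectation value with respect to the probabilistic
measure Z_{s,t}^{−1} dμ … χ_k exp[… + {….}_{s,t} + tV^{(k)}(S_k)]"* (3.27). [cite: Balaban1988Convergent, (3.27) p.271] -/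
def gibbsExpect (ν : Measure Ω) (w : Ω → ℝ) (S : ℝ → Ω → ℝ) (G : Ω → ℝ) (t : ℝ) : ℝ :=
  gibbsNum ν w S G t / partFn ν w S t

/-- THE PROBABILISTIC MEASURE of (3.27): `Z_t⁻¹ · (w e^{S_t}) dν`. [cite: Balaban1988Convergent, (3.27) p.271] -/
def gibbsLaw (ν : Measure Ω) (w : Ω → ℝ) (S : ℝ → Ω → ℝ) (t : ℝ) : Measure Ω :=
  (ENNReal.ofReal (partFn ν w S t))⁻¹ • ν.withDensity fun ω => ENNReal.ofReal (gibbsWeight w S t ω)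

/-- The standing data of the Gibbs form of (3.27) on the parameter interval `(a,b) ⊃ [0,1]`: an integrable reference weight
`w ≥ 0` a.e. of positive integral, and an exponent `S t ω` with a.e.-bounded values and a.e.-bounded `t`-derivative
`S' t ω` (in print: bounded analytic functions of the fields on the domain cut out by `χ_k`; the bounds enter only
qualitatively). [cite: Balaban1988Convergent, (3.27) p.271] -/
structure GibbsFamily (ν : Measure Ω) (w : Ω → ℝ) (S S' : ℝ → Ω → ℝ) (a b : ℝ) : Prop where
  /-- the parameter interval `(a,b)` contains `[0,1]`: left end -/
  lo : a < 0
  /-- … right end -/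
  hi : 1 < b
  /-- the reference weight is integrable -/
  w_int : Integrable w ν
  /-- … non-negative a.e. -/
  w_nonneg : 0 ≤ᵐ[ν] w
  /-- … of positive integral (not a.e. zero) -/
  w_pos : 0 < ∫ ω, w ω ∂ν
  /-- each exponent section is a.e.-strongly measurable -/
  S_meas : ∀ t ∈ Ioo a b, AEStronglyMeasurable (S t) ν
  /-- each derivative section is a.e.-strongly measurable -/
  S'_meas : ∀ t ∈ Ioo a b, AEStronglyMeasurable (S' t) ν
  /-- for a.e. `ω`, `t ↦ S t ω` is differentiable on `(a,b)` with derivative `S' t ω` -/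
  S_deriv : ∀ᵐ ω ∂ν, ∀ t ∈ Ioo a b, HasDerivAt (fun t => S t ω) (S' t ω) t
  /-- the exponent is a.e. bounded on `(a,b)` -/
  S_bdd : ∃ K : ℝ, ∀ᵐ ω ∂ν, ∀ t ∈ Ioo a b, |S t ω| ≤ K
  /-- its derivative is a.e. bounded on `(a,b)` -/
  S'_bdd : ∃ K' : ℝ, ∀ᵐ ω ∂ν, ∀ t ∈ Ioo a b, |S' t ω| ≤ K'

namespace GibbsFamily

variable {ν : Measure Ω} {w : Ω → ℝ} {S S' : ℝ → Ω → ℝ} {a b : ℝ}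

/-- `[0,1] ⊂ (a,b)`. [cite: Balaban1988Convergent, (3.27) p.271] -/
theorem Icc_subset (h : GibbsFamily ν w S S' a b) : Icc (0:ℝ) 1 ⊆ Ioo a b :=
  fun _ ht => ⟨lt_of_lt_of_le h.lo ht.1, lt_of_le_of_lt ht.2 h.hi⟩

/-- Measurability of the tilted weight. [cite: Balaban1988Convergent, (3.27) p.271] -/
theorem aestronglyMeasurable_gibbsWeight (h : GibbsFamily ν w S S' a b) {t : ℝ} (ht : t ∈ Ioo a b) :
    AEStronglyMeasurable (gibbsWeight w S t) ν :=
  h.w_int.aestronglyMeasurable.mul (Real.continuous_exp.comp_aestronglyMeasurable (h.S_meas t ht))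

/-- The tilted weight is non-negative a.e. [cite: Balaban1988Convergent, (3.27) p.271] -/
theorem gibbsWeight_nonneg (h : GibbsFamily ν w S S' a b) (t : ℝ) : 0 ≤ᵐ[ν] gibbsWeight w S t := by
  filter_upwards [h.w_nonneg] with ω hω using mul_nonneg hω (Real.exp_nonneg _)

/-- Two-sided control of the tilted weight by the reference weight: `w e^{−K} ≤ w e^{S_t} ≤ w e^{K}` a.e.
[cite: Balaban1988Convergent, (3.27) p.271] -/
theorem gibbsWeight_le (h : GibbsFamily ν w S S' a b) {K : ℝ} (hK : ∀ᵐ ω ∂ν, ∀ t ∈ Ioo a b, |S t ω| ≤ K)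
    {t : ℝ} (ht : t ∈ Ioo a b) :
    ∀ᵐ ω ∂ν, w ω * Real.exp (-K) ≤ gibbsWeight w S t ω ∧ gibbsWeight w S t ω ≤ w ω * Real.exp K := by
  filter_upwards [hK, h.w_nonneg] with ω hω hw
  have h1 := abs_le.1 (hω t ht)
  exact ⟨mul_le_mul_of_nonneg_left (Real.exp_le_exp.2 h1.1) hw,
    mul_le_mul_of_nonneg_left (Real.exp_le_exp.2 h1.2) hw⟩

/-- A bounded measurable insert times the tilted weight is integrable (`|G w e^{S_t}| ≤ R|w|e^{K}`).
[cite: Balaban1988Convergent, (3.27) p.271] -/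
theorem integrable_mul_gibbsWeight (h : GibbsFamily ν w S S' a b) {G : Ω → ℝ} (hG : AEStronglyMeasurable G ν)
    {R : ℝ} (hR : ∀ᵐ ω ∂ν, |G ω| ≤ R) {t : ℝ} (ht : t ∈ Ioo a b) :
    Integrable (fun ω => G ω * gibbsWeight w S t ω) ν := by
  obtain ⟨K, hK⟩ := h.S_bdd
  refine Integrable.mono' ((h.w_int.abs.mul_const (Real.exp K)).const_mul R)
    (hG.mul (h.aestronglyMeasurable_gibbsWeight ht)) ?_
  filter_upwards [hR, h.gibbsWeight_le hK ht, h.gibbsWeight_nonneg t, h.w_nonneg] with ω hω hle hnn hw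
  rw [Real.norm_eq_abs, abs_mul, abs_of_nonneg hnn, abs_of_nonneg hw]
  exact mul_le_mul hω hle.2 hnn ((abs_nonneg _).trans hω)

/-- The tilted weight is integrable. [cite: Balaban1988Convergent, (3.27) p.271] -/
theorem integrable_gibbsWeight (h : GibbsFamily ν w S S' a b) {t : ℝ} (ht : t ∈ Ioo a b) :
    Integrable (gibbsWeight w S t) ν := by
  simpa only [one_mul] using h.integrable_mul_gibbsWeight (G := fun _ => (1:ℝ)) aestronglyMeasurable_const
    (R := 1) (ae_of_all _ fun _ => by simp) ht

/-- THE NORMALIZATION FACTOR IS POSITIVE: `Z_t ≥ e^{−K} ∫ w dν > 0` — so `log Z_t` and `Z_t⁻¹` in (3.26)/(3.27) are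
meaningful. [cite: Balaban1988Convergent, (3.27) p.271] -/
theorem partFn_pos (h : GibbsFamily ν w S S' a b) {t : ℝ} (ht : t ∈ Ioo a b) : 0 < partFn ν w S t := by
  obtain ⟨K, hK⟩ := h.S_bdd
  have hle : (∫ ω, w ω ∂ν) * Real.exp (-K) ≤ partFn ν w S t := by
    rw [partFn, ← MeasureTheory.integral_mul_const]
    refine integral_mono_ae (h.w_int.mul_const _) (h.integrable_gibbsWeight ht) ?_
    filter_upwards [h.gibbsWeight_le hK ht] with ω hω
    exact hω.1
  exact lt_of_lt_of_le (mul_pos h.w_pos (Real.exp_pos _)) hle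

/-- The Gibbs form is a dominated differentiable family (§1) with `F_t = w e^{S_t}`, `∂_tF_t = (∂_tS_t)·w e^{S_t}`,
dominating function `K'·w·e^{K}`. [cite: Balaban1988Convergent, (3.27) p.271] -/
theorem toDomFamily (h : GibbsFamily ν w S S' a b) :
    DomFamily ν (gibbsWeight w S) (fun t ω => S' t ω * gibbsWeight w S t ω) a b := by
  obtain ⟨K, hK⟩ := h.S_bdd
  obtain ⟨K', hK'⟩ := h.S'_bdd
  refine ⟨h.lo, h.hi, fun t ht => h.aestronglyMeasurable_gibbsWeight ht,
    fun t ht => (h.S'_meas t ht).mul (h.aestronglyMeasurable_gibbsWeight ht),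
    fun t ht => h.integrable_gibbsWeight ht, ?_, ?_, fun t ht => h.partFn_pos ht⟩
  · filter_upwards [h.S_deriv] with ω hω t ht
    refine (((hω t ht).exp).const_mul (w ω)).congr_deriv ?_
    simp only [gibbsWeight]; ring
  · refine ⟨fun ω => K' * (|w ω| * Real.exp K), (h.w_int.abs.mul_const (Real.exp K)).const_mul K', ?_⟩
    filter_upwards [hK, hK', h.w_nonneg] with ω hω hω' hw t ht
    have h1 := abs_le.1 (hω t ht)
    have hgw : gibbsWeight w S t ω ≤ w ω * Real.exp K :=
      mul_le_mul_of_nonneg_left (Real.exp_le_exp.2 h1.2) hw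
    have hnn : 0 ≤ gibbsWeight w S t ω := mul_nonneg hw (Real.exp_nonneg _)
    rw [abs_mul, abs_of_nonneg hnn, abs_of_nonneg hw]
    exact mul_le_mul (hω' t ht) hgw hnn ((abs_nonneg _).trans (hω' t ht))

/-- DIFFERENTIATION OF THE NORMALIZATION FACTOR under the integral: `d/dt Z_t = ∫ (∂_tS_t) w e^{S_t} dν`.
[cite: Balaban1988Convergent, (3.27) p.271] -/
theorem hasDerivAt_partFn (h : GibbsFamily ν w S S' a b) {t₀ : ℝ} (ht₀ : t₀ ∈ Ioo a b) :
    HasDerivAt (partFn ν w S) (gibbsNum ν w S (S' t₀) t₀) t₀ :=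
  h.toDomFamily.hasDerivAt_integral ht₀

/-- **(3.27), THE MEANING OF `⟨·⟩_{s,t}` FOR ACTUAL INTEGRALS**: the derivative of the logarithm of the tilted integral is
the tilted expectation of the derivative of the exponent, `d/dt log Z_t = ⟨∂_tS_t⟩_t`, at every `t₀ ∈ (a,b) ⊃ [0,1]`.
(For the finite model see `B14.Interpolation.hasDerivAt_log_tiltedSum`.) [cite: Balaban1988Convergent, (3.27) p.271] -/
theorem hasDerivAt_log_partFn (h : GibbsFamily ν w S S' a b) {t₀ : ℝ} (ht₀ : t₀ ∈ Ioo a b) :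
    HasDerivAt (fun t => Real.log (partFn ν w S t)) (gibbsExpect ν w S (S' t₀) t₀) t₀ :=
  h.toDomFamily.hasDerivAt_log_integral ht₀

/-- A tilted expectation of a bounded insert is bounded by the same constant: `|⟨G⟩_t| ≤ R` if `|G| ≤ R` a.e.
[cite: Balaban1988Convergent, (3.27) p.271] -/
theorem abs_gibbsExpect_le (h : GibbsFamily ν w S S' a b) {G : Ω → ℝ} {R : ℝ} (hR : ∀ᵐ ω ∂ν, |G ω| ≤ R) {t : ℝ}
    (ht : t ∈ Ioo a b) : |gibbsExpect ν w S G t| ≤ R := by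
  have hZ := h.partFn_pos ht
  have hN : |gibbsNum ν w S G t| ≤ R * partFn ν w S t := by
    rw [gibbsNum, partFn, ← MeasureTheory.integral_const_mul]
    have h1 : ‖∫ ω, G ω * gibbsWeight w S t ω ∂ν‖ ≤ ∫ ω, R * gibbsWeight w S t ω ∂ν := by
      apply MeasureTheory.norm_integral_le_of_norm_le ((h.integrable_gibbsWeight ht).const_mul R)
      filter_upwards [hR, h.gibbsWeight_nonneg t] with ω hω hnn
      rw [Real.norm_eq_abs, abs_mul, abs_of_nonneg hnn]
      exact mul_le_mul_of_nonneg_right hω hnn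
    simpa [Real.norm_eq_abs] using h1
  rw [gibbsExpect, abs_div, abs_of_pos hZ, div_le_iff₀ hZ]
  exact hN

/-- The log-derivative `t ↦ ⟨∂_tS_t⟩_t` is interval-integrable on `[0,1]`. [cite: Balaban1988Convergent, (3.27) p.271] -/
theorem intervalIntegrable_gibbsExpect (h : GibbsFamily ν w S S' a b) :
    IntervalIntegrable (fun t => gibbsExpect ν w S (S' t) t) volume 0 1 :=
  h.toDomFamily.intervalIntegrable_logDeriv

/-- **(3.30) [and (3.32) in Gibbs form] FOR ACTUAL INTEGRALS**: `log Z_1 = log Z_0 + ∫₀¹ dt ⟨∂_tS_t⟩_t` — the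
row-of-record display `B14.Interpolation.Eq330`, *"where the expectation value is with respect to the probabilistic
measure defined by the function … in the logarithm"* (p. 272). [cite: Balaban1988Convergent, (3.30) p.272] -/
theorem eq330_gibbs (h : GibbsFamily ν w S S' a b) :
    B14.Interpolation.Eq330 (fun t => Real.log (partFn ν w S t)) (fun t => gibbsExpect ν w S (S' t) t) :=
  h.toDomFamily.eq330_family

/-! ### The probabilistic measure of (3.27) -/

/-- **(3.27): the tilted law is a PROBABILITY MEASURE** (*"the probabilistic measure Z_{s,t}^{−1} dμ … χ_k exp[…]"*).
[cite: Balaban1988Convergent, (3.27) p.271] -/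
theorem isProbabilityMeasure_gibbsLaw (h : GibbsFamily ν w S S' a b) {t : ℝ} (ht : t ∈ Ioo a b) :
    IsProbabilityMeasure (gibbsLaw ν w S t) := by
  have hZ := h.partFn_pos ht
  refine ⟨?_⟩
  rw [gibbsLaw, Measure.smul_apply, smul_eq_mul, withDensity_apply _ MeasurableSet.univ, Measure.restrict_univ,
    ← ofReal_integral_eq_lintegral_ofReal (h.integrable_gibbsWeight ht) (h.gibbsWeight_nonneg t)]
  exact ENNReal.inv_mul_cancel (ENNReal.ofReal_pos.2 hZ).ne' ENNReal.ofReal_ne_top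

/-- **(3.27): `⟨G⟩_t` IS the expectation against the tilted law**: `∫ G d(gibbsLaw_t) = Z_t⁻¹ ∫ G w e^{S_t} dν`.
[cite: Balaban1988Convergent, (3.27) p.271] -/
theorem integral_gibbsLaw (h : GibbsFamily ν w S S' a b) {t : ℝ} (ht : t ∈ Ioo a b) (G : Ω → ℝ) :
    ∫ ω, G ω ∂(gibbsLaw ν w S t) = gibbsExpect ν w S G t := by
  have hZ := h.partFn_pos ht
  rw [gibbsLaw, MeasureTheory.integral_smul_measure, integral_withDensity_eq_integral_toReal_smul₀
    (show AEMeasurable (fun ω => ENNReal.ofReal (gibbsWeight w S t ω)) ν from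
      ENNReal.measurable_ofReal.comp_aemeasurable (h.aestronglyMeasurable_gibbsWeight ht).aemeasurable)
    (ae_of_all _ fun _ => ENNReal.ofReal_lt_top),
    ENNReal.toReal_inv, ENNReal.toReal_ofReal hZ.le, gibbsExpect, gibbsNum, div_eq_inv_mul, smul_eq_mul]
  congr 1
  refine integral_congr_ae ?_
  filter_upwards [h.gibbsWeight_nonneg t] with ω hω
  rw [ENNReal.toReal_ofReal hω, smul_eq_mul, mul_comm]

end GibbsFamily

end Literature.MathematicalPhysics.QuantumFieldTheory.Balaban1983to89.B14.InterpolationMeasure
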